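import Summits.AnomalousDissipation.AnomalousDissipation.Theorems.SawtoothPulseCascadeK3LocalisedClosureExistenceAssembly
import Summits.AnomalousDissipation.AnomalousDissipation.Theorems.SawtoothPulseCascadeConstructionRegular58
import Summits.AnomalousDissipation.AnomalousDissipation.Theorems.SawtoothPulseCascadePlanarForceMeanZero

/-!
# K3loc, line `DriftFree` — `Existence` on the box from planar Navier–Stokes solvability on closed windows

Helper for the stub `stub_packaging` (v4; conjunct (b) = `∀ box, DriftFree.Existence ⟨γ, 1/4, 2, 1, ρN⟩`, = `stub_existence`
of v3) of the crux `K3LocalisedClosure` (stmt-AnomalousDissipation-19492): the box statement follows from ONE classical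
well-posedness input for the forced planar Navier–Stokes system on closed windows `[0, τ] × 𝕋²` — for smooth,
divergence-free, mean-zero forces and the zero datum (2D global regularity: Ladyzhenskaya 1959; Foias–Manley–Rosa–Temam
Thm. 7.4; Kuksin–Shirikyan Thm. 2.1.13 / 2.1.18–19; being typed by the cell's literature seat as
`Torus.exists_classicalNS_forced_fin_two`) — by the lead's `DriftFreeExistence.existence_of_windows` and the support
seat's force facts `Cascade.isSmoothSpaceTimeOn_planarForce` / `isDivFree_planarForce` / `hasZeroMean_planarForce`.
-/

-- `Summit.<Summit>.<Problem>`: single-conjunct summit, the duplicate namespace segment is deliberate.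
set_option linter.dupNamespace false

noncomputable section

namespace Summit.AnomalousDissipation.AnomalousDissipation.Theorems.SawtoothPulseCascade.DriftFreeExistence

open scoped InnerProductSpace ENNReal NNReal
open MeasureTheory Set Filter Topology
open Literature.Analysis Literature.Analysis.FunctionSpaces Literature.Analysis.FluidPDE
open Literature.Analysis.FluidPDE.SawtoothCascade
open Literature.Analysis.FluidPDE.SawtoothCascade.DriftFree

/-- **`Existence` on the box from closed-window planar Navier–Stokes solvability** (smooth, divergence-free, mean-zero
forces; zero datum): the force `planarForce ⟨γ, 1/4, 2, 1, ρN⟩` qualifies at every box point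
(`Cascade.isSmoothSpaceTimeOn_planarForce`, `isDivFree_planarForce`, `hasZeroMean_planarForce`), and
`existence_of_windows` assembles the rest. [folklore] -/
theorem existence58_of_planarNS
    (hNS : ∀ (ν τ : ℝ), 0 < ν → 0 < τ →
      ∀ f : ℝ → UnitAddTorus (Fin 2) → EuclideanSpace ℝ (Fin 2),
        FunctionSpaces.Torus.IsSmoothSpaceTimeOn (Icc 0 τ) f →
        (∀ t ∈ Icc 0 τ, FunctionSpaces.Torus.IsDivFree (f t)) →
        (∀ t ∈ Icc 0 τ, FunctionSpaces.Torus.HasZeroMean (f t)) →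
          ∃ (V : ℝ → UnitAddTorus (Fin 2) → EuclideanSpace ℝ (Fin 2)) (φ : ℝ → UnitAddTorus (Fin 2) → ℝ),
            FunctionSpaces.Torus.IsClassicalNSSolutionOn (Icc 0 τ) ν f V φ ∧ V 0 = 0) :
    ∀ γ ∈ Icc (5 : ℝ) 8, ∀ ρN ∈ Finset.Icc 2 7, Existence ⟨γ, 1 / 4, 2, 1, ρN⟩ := by
  intro γ hγ ρN hρN
  have hρ2 : 2 ≤ ρN := (Finset.mem_Icc.1 hρN).1
  set P : CascadeParams := ⟨γ, 1 / 4, 2, 1, ρN⟩ with hP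
  have hδ₀ : 0 < P.δ₀ := by simp only [hP]; norm_num
  have hd : 0 < P.d := by simp only [hP]; norm_num
  refine existence_of_windows P hδ₀ hd le_rfl hρ2 fun ν hν τ hτ => ?_
  have hI : Icc 0 τ ⊆ Ico (0 : ℝ) 1 := fun s hs => ⟨hs.1, hs.2.trans_lt hτ.2⟩
  exact hNS ν τ hν hτ.1 (planarForce P) ((Cascade.isSmoothSpaceTimeOn_planarForce P hδ₀ hd).mono hI)
    (fun t _ => Cascade.isDivFree_planarForce P hδ₀ hd t) (fun t _ => Cascade.hasZeroMean_planarForce P hδ₀ hd t)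

end Summit.AnomalousDissipation.AnomalousDissipation.Theorems.SawtoothPulseCascade.DriftFreeExistence

end
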